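import Summits.BirchSwinnertonDyer.BirchSwinnertonDyer.Theorems.ClassRecordThreeCartanCuspRowInduced
import HarnessLib

/-!
# The cuspidal row of `GL₂(𝔽_q)` by orthogonality counting, II: class values of `Ind_{ZN} ψ` ∕ `Ind_{T_η} ν` and NORM ONE of their difference — realform §O.4–§O.5

Lift-only port (cell bsd-stepL, SUMMON key `ghostlift`, director-bsd (837) «(κ2) GHOSTLIFT: GO NOW» 2026-08-31; lift by tam3-p1 g43) of §O.4–§O.5 (source lines 1764–1967, `section Cusprow`) of the crux-ideate workfile
`Summits/BirchSwinnertonDyer/BirchSwinnertonDyer/Cruxes/CartanOnePlaceDegreeLawAtThree/Lines/realform.lean` (lineage `cruxidea-stmt-BirchSwinnertonDyer-24801-1`, generation 29, commit 91f4f181dd15, sha256-16 989f1973431c01d3, 2699 l.; farm rc 0, sorries 5 = its §4 stubs, none of which is lifted; referee FULL BATTERY PASS `VERDICT-REALFORM-G29-g94.md`, §O ≡ generation 28's `Lines/cusprow.lean` §O byte-identical, referee `VERDICT-CUSPROW-G28-g93.md`).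
AUTHORS OF THE BYTES: cruxidea-24801 generation 28 (`cusprow`, §O) — carried verbatim by generation 29 (`realform`). Declarations, statements and proofs below are token-identical to the source; the only edits are the namespace
(`…Cruxes.CartanOnePlaceDegreeLawAtThree.Realform` ↦ `…Theorems.CartanDoubleCoset`, shared with the `ClassRecordThreeCartanSupply*` lift modules), the imports ∕ `open`s ∕
section preamble each module needs, and one-line docstrings added where the source had none. Nothing is re-stated, weakened or re-proved.

CONTENT (finite group theory of `G = GL₂(𝔽_q)`, `q` odd prime). §O.4 (`section Values`) the class values of `A := Ind_{ZN}^G ψ` and `B_ν := Ind_{T_η}^G ν` (`ν|_Z = 1`)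
on the classes meeting `ZN` or `T_η`: `valA_scalar = q² − 1`, `valA_torus = 0`, `valA_parabolic = −1`, `valB_scalar = q(q − 1)`, `valB_parabolic = 0`, `valB_torus = ν + ν⁻¹`;
`hom_ne_zero`, `sum_sq_inv_eq_zero`. §O.5 NORM ONE `normOne_cuspRow`: `Σ_g f(g) f(g⁻¹) = |G|` for `f = χ_A − χ_{B_ν}` (`ψ ≠ 1`, `ν|_Z = 1`, `ν² ≠ 1`) by four Frobenius
pairings, hence an IRREDUCIBLE `U_ν` with `χ_{U_ν} = χ_A − χ_{B_ν}` (`exists_irreducible_cuspRow`, through the tree's Hom-stripping engine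
`CartanSupply.VirtualCharacter.exists_irreducible_of_virtual_normOne`) — the cuspidal representation `π(ν)` by virtual-character arithmetic alone.

HONEST: a `--supports stmt-BirchSwinnertonDyer-24801 --as helper` module of PROVED finite-group theory ∕ lattice bookkeeping; it closes NO registered stub and NO leaf of
24801 — the five stubs of registry `Lines/jacquet.lean` rev 10.1 ((JV) · (NCB) · (CV♭) · (DS) ∧ (JLᶜ) · (MO1ᴾ)) stand, the registry is untouched by this module, no count moves
(1∕12 · 0∕12), nothing about NUM ∕ NUM♮ ∕ 24801 ∕ 32276 ∕ 19109 is proved for any curve; BSD is proved for no curve.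
-/

set_option linter.dupNamespace false  -- `Summit.BirchSwinnertonDyer.BirchSwinnertonDyer.…` (summit = problem), as every file of this directory
set_option autoImplicit false

noncomputable section

open scoped Classical MatrixGroups
open Matrix

namespace Summit.BirchSwinnertonDyer.BirchSwinnertonDyer.Theorems.CartanDoubleCoset

open Summit.BirchSwinnertonDyer.BirchSwinnertonDyer.Theorems
open Summit.BirchSwinnertonDyer.BirchSwinnertonDyer.Theorems.CartanDegree (HasRatEigenvalue)
open Summit.BirchSwinnertonDyer.BirchSwinnertonDyer.Theorems.CartanTorusCubeCut (torusSubgroup mem_torusSubgroup lin linGL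
  linGL_coe lin_comm torusSubgroup_isCyclic card_torusSubgroup)
open Summit.BirchSwinnertonDyer.BirchSwinnertonDyer.Theorems.CartanCover (splitGen mem_splitTorus_iff)
open Summit.BirchSwinnertonDyer.BirchSwinnertonDyer.Theorems.CartanCover.Charext.InertHecke (upperUnip lowerUnip coe_upperUnip
  coe_lowerUnip upperUnip_mul upperUnip_zero exists_unip_factorization)
open Summit.BirchSwinnertonDyer.BirchSwinnertonDyer.Theorems.CartanCover
open Summit.BirchSwinnertonDyer.BirchSwinnertonDyer.Theorems.CartanTorusCubeCut

section Cusprow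

open Representation (IntertwiningMap)
open Summit.BirchSwinnertonDyer.BirchSwinnertonDyer.Theorems.CartanTorusCubeCut (G Mat)
open Summit.BirchSwinnertonDyer.BirchSwinnertonDyer.Theorems.CartanSupply.Monomial
open Summit.BirchSwinnertonDyer.BirchSwinnertonDyer.Theorems.CartanSupply.VirtualCharacter (exists_irreducible_of_virtual_normOne
  sum_char_mul_char_inv)

variable {q : ℕ} [Fact q.Prime]

variable {eta : Mat q}

/-! ### §O.4 Class values of `A := Ind_{ZN}^G ψ` and `B_ν := Ind_{T_η}^G ν` (`ν|_Z = 1`) on the classes that meet `ZN` or `T_η` -/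

section Values

variable (hq2 : q ≠ 2) (hη : ¬ HasRatEigenvalue eta) (ψ : AddChar (ZMod q) ℂ) (ν : torusSubgroup eta →* ℂ)
  (hZ : ∀ x : torusSubgroup eta, CartanDegree.IsScalarMat ((x : G q) : Mat q) → ν x = 1)
include hη

omit hη in
/-- SCALAR class: `χ_A(z) = q² − 1`. -/
theorem valA_scalar {g : G q} (hs : CartanDegree.IsScalarMat (g : Mat q)) : (monRep (znSub q) (znChar ψ)).character g = (q : ℂ) ^ 2 - 1 :=
  znChar_scalar ψ hs

include hq2 in
/-- ELLIPTIC class (non-scalar element of `T_η`): `χ_A(t) = 0`. -/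
theorem valA_torus {t : G q} (ht : t ∈ torusSubgroup eta) (hns : ¬ CartanDegree.IsScalarMat (t : Mat q)) :
    (monRep (znSub q) (znChar ψ)).character t = 0 :=
  znChar_of_discr_ne_zero ψ fun hΔ =>
    CartanSupply.NormOne.nonsplitTorus_types hη (mem_nonsplitTorus_iff.2 ht) hns (CartanSupply.NormOne.hasRatEigenvalue_of_discr_eq_zero hq2 hΔ)

omit hη in
include hq2 in
/-- PARABOLIC class: `χ_A(a b; 0 a) = −1` (`b ≠ 0`, `ψ ≠ 1`). -/
theorem valA_parabolic (hψ : ψ ≠ 1) (a : (ZMod q)ˣ) {b : ZMod q} (hb : b ≠ 0) : (monRep (znSub q) (znChar ψ)).character (upperGL a a b) = -1 :=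
  znChar_parabolic hψ (fun hs => hb ((isScalarMat_upperGL_iff a a b).1 hs).1) (discr_upperGL_self a b) hq2

include hZ in
/-- SCALAR class: `χ_{B_ν}(z) = q(q − 1)` (`ν|_Z = 1`). -/
theorem valB_scalar {g : G q} (hs : CartanDegree.IsScalarMat (g : Mat q)) : (monRep (torusSubgroup eta) ν).character g = (q : ℂ) * ((q : ℂ) - 1) := by
  have hgT : g ∈ torusSubgroup eta := mem_nonsplitTorus_iff.1 (CartanSupply.NormOne.mem_nonsplitTorus_of_isScalar eta hs)
  rw [torusIndGen_scalar hη ν hs, wt_of_mem _ _ hgT, hZ ⟨g, hgT⟩ hs, mul_one]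

include hq2 in
/-- PARABOLIC class: `χ_{B_ν}(a b; 0 a) = 0` (`b ≠ 0`). -/
theorem valB_parabolic (a : (ZMod q)ˣ) {b : ZMod q} (hb : b ≠ 0) : (monRep (torusSubgroup eta) ν).character (upperGL a a b) = 0 :=
  torusIndGen_of_hasRatEigenvalue hη ν (fun hs => hb ((isScalarMat_upperGL_iff a a b).1 hs).1)
    (CartanSupply.NormOne.hasRatEigenvalue_of_discr_eq_zero hq2 (discr_upperGL_self a b))

include hq2 hZ in
/-- ELLIPTIC class: `χ_{B_ν}(t) = ν(t) + ν(t)⁻¹` (`ν|_Z = 1`). -/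
theorem valB_torus {t : G q} (ht : t ∈ torusSubgroup eta) (hns : ¬ CartanDegree.IsScalarMat (t : Mat q)) :
    (monRep (torusSubgroup eta) ν).character t = ν ⟨t, ht⟩ + (ν ⟨t, ht⟩)⁻¹ := by
  rw [torusIndGen_torus hq2 hη ν ht hns, partner_eq_inv ν hZ ht]

omit hη in
/-- a character of a finite group never vanishes. -/
theorem hom_ne_zero (t : torusSubgroup eta) : ν t ≠ 0 := fun h0 => by
  have h := map_mul ν t t⁻¹
  rw [mul_inv_cancel, map_one, h0, zero_mul] at h
  exact one_ne_zero h

omit hη in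
/-- `Σ_t ν(t⁻¹)² = 0` when `ν² ≠ 1`. -/
theorem sum_sq_inv_eq_zero (hreg : ∃ t : torusSubgroup eta, ν t ^ 2 ≠ 1) : ∑ t : torusSubgroup eta, ν t⁻¹ ^ 2 = 0 := by
  have hne : ν ^ 2 ≠ 1 := by
    obtain ⟨t, ht⟩ := hreg
    intro h
    apply ht
    have := DFunLike.congr_fun h t
    rwa [MonoidHom.pow_apply, MonoidHom.one_apply] at this
  calc ∑ t : torusSubgroup eta, ν t⁻¹ ^ 2 = ∑ t : torusSubgroup eta, (ν ^ 2) t :=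
        Fintype.sum_equiv (Equiv.inv (torusSubgroup eta)) _ _ (fun t => by rw [Equiv.inv_apply, MonoidHom.pow_apply])
    _ = 0 := sum_hom_units_eq_zero (ν ^ 2) hne

end Values

/-! ### §O.5 NORM ONE: `Σ_g f(g) f(g⁻¹) = |G|` for `f = χ_A − χ_{B_ν}` (`ψ ≠ 1`, `ν|_Z = 1`, `ν² ≠ 1`, `q` odd), by four Frobenius pairings;
hence an IRREDUCIBLE `U_ν` with `χ_{U_ν} = χ_A − χ_{B_ν}` (the tree's Hom-stripping engine `exists_irreducible_of_virtual_normOne`) -/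

/-- **NORM ONE**: `Σ_g f(g) f(g⁻¹) = |G|` for `f = χ_{Ind_{ZN} ψ} − χ_{Ind_{T_η} ν}` (`ψ ≠ 1`, `ν|_Z = 1`, `ν² ≠ 1`, `q` odd), by the four Frobenius pairings (AA), (BA), (AB), (BB). -/
theorem normOne_cuspRow (hq2 : q ≠ 2) (hη : ¬ HasRatEigenvalue eta) {ψ : AddChar (ZMod q) ℂ} (hψ : ψ ≠ 1)
    (ν : torusSubgroup eta →* ℂ) (hZ : ∀ x : torusSubgroup eta, CartanDegree.IsScalarMat ((x : G q) : Mat q) → ν x = 1)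
    (hreg : ∃ t : torusSubgroup eta, ν t ^ 2 ≠ 1) :
    ∑ g : G q, ((monRep (znSub q) (znChar ψ)).character g - (monRep (torusSubgroup eta) ν).character g) *
      ((monRep (znSub q) (znChar ψ)).character g⁻¹ - (monRep (torusSubgroup eta) ν).character g⁻¹) = Fintype.card (G q) := by
  set A := monRep (znSub q) (znChar ψ) with hA
  set B := monRep (torusSubgroup eta) ν with hB
  have hpr := (Fact.out : q.Prime)
  have hq0 : (q : ℂ) ≠ 0 := Nat.cast_ne_zero.2 hpr.ne_zero
  have hq1 : ((q : ℂ) - 1) ≠ 0 := by rw [sub_ne_zero]; exact_mod_cast hpr.one_lt.ne'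
  have hq1' : ((q : ℂ) + 1) ≠ 0 := by exact_mod_cast Nat.succ_ne_zero q
  have hcastq1 : (((q - 1 : ℕ)) : ℂ) = (q : ℂ) - 1 := by rw [Nat.cast_sub hpr.one_lt.le, Nat.cast_one]
  have hνinv_s : ∀ t : torusSubgroup eta, CartanDegree.IsScalarMat ((t : G q) : Mat q) → ν t⁻¹ = 1 := fun t hs =>
    hZ t⁻¹ (by rw [Subgroup.coe_inv]; exact (CartanSupply.isScalarMat_coe_inv_iff (t : G q)).2 hs)
  -- (AA) over `ZN`
  have iAA : ∑ h : znSub q, A.character h * znChar ψ h⁻¹ = ((q : ℂ) - 1) * (q : ℂ) ^ 2 := by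
    rw [sum_znSub_eq]
    have hterm : ∀ p : (ZMod q)ˣ × ZMod q,
        A.character ((⟨upperGL p.1 p.1 p.2, upperGL_mem_znSub p.1 p.2⟩ : znSub q) : G q) *
          znChar ψ (⟨upperGL p.1 p.1 p.2, upperGL_mem_znSub p.1 p.2⟩ : znSub q)⁻¹ =
        if p.2 = 0 then (q : ℂ) ^ 2 - 1 else -ψ (p.2 * -((p.1 : ZMod q)⁻¹)) := by
      rintro ⟨a, b⟩
      rw [map_inv, znChar_upperGL]
      dsimp only
      by_cases hb : b = 0
      · rw [if_pos hb, hb, zero_mul, AddChar.map_zero_eq_one, inv_one, mul_one]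
        exact valA_scalar ψ ((isScalarMat_upperGL_iff a a 0).2 ⟨rfl, rfl⟩)
      · rw [if_neg hb, valA_parabolic hq2 ψ hψ a hb, ← AddChar.map_neg_eq_inv, mul_neg, neg_mul, one_mul, neg_mul_eq_mul_neg]
    rw [Fintype.sum_congr _ _ hterm, Fintype.sum_prod_type]
    have hin : ∀ a : (ZMod q)ˣ, (∑ b : ZMod q, if b = 0 then (q : ℂ) ^ 2 - 1 else -ψ (b * -((a : ZMod q)⁻¹))) = (q : ℂ) ^ 2 := by
      intro a
      rw [← Finset.add_sum_erase _ _ (Finset.mem_univ (0 : ZMod q)), if_pos rfl, ← Finset.filter_ne',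
        Finset.sum_congr rfl (fun b hb => if_neg (Finset.mem_filter.1 hb).2), Finset.sum_neg_distrib,
        sum_ne_zero_addChar hψ (neg_ne_zero.2 (inv_ne_zero a.ne_zero))]
      ring
    rw [Finset.sum_congr rfl (fun a _ => hin a), Finset.sum_const, Finset.card_univ, ZMod.card_units q, nsmul_eq_mul, hcastq1]
  -- (BA) over `ZN`
  have iBA : ∑ h : znSub q, B.character h * znChar ψ h⁻¹ = (q : ℂ) * ((q : ℂ) - 1) ^ 2 := by
    rw [sum_znSub_eq]
    have hterm : ∀ p : (ZMod q)ˣ × ZMod q,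
        B.character ((⟨upperGL p.1 p.1 p.2, upperGL_mem_znSub p.1 p.2⟩ : znSub q) : G q) *
          znChar ψ (⟨upperGL p.1 p.1 p.2, upperGL_mem_znSub p.1 p.2⟩ : znSub q)⁻¹ =
        if p.2 = 0 then (q : ℂ) * ((q : ℂ) - 1) else 0 := by
      rintro ⟨a, b⟩
      rw [map_inv, znChar_upperGL]
      dsimp only
      by_cases hb : b = 0
      · rw [if_pos hb, hb, zero_mul, AddChar.map_zero_eq_one, inv_one, mul_one]
        exact valB_scalar hη ν hZ ((isScalarMat_upperGL_iff a a 0).2 ⟨rfl, rfl⟩)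
      · rw [if_neg hb, valB_parabolic hq2 hη ν a hb, zero_mul]
    rw [Fintype.sum_congr _ _ hterm, Fintype.sum_prod_type]
    simp_rw [Finset.sum_ite_eq' Finset.univ (0 : ZMod q)]
    simp only [Finset.mem_univ, if_true, Finset.sum_const, Finset.card_univ, ZMod.card_units q, nsmul_eq_mul]
    rw [hcastq1]; ring
  -- (AB) over `T_η`
  have iAB : ∑ t : torusSubgroup eta, A.character t * ν t⁻¹ = ((q : ℂ) - 1) * ((q : ℂ) ^ 2 - 1) := by
    rw [← Finset.sum_filter_add_sum_filter_not Finset.univ (fun t : torusSubgroup eta => CartanDegree.IsScalarMat ((t : G q) : Mat q))]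
    have h1 : ∑ t ∈ Finset.univ.filter (fun t : torusSubgroup eta => CartanDegree.IsScalarMat ((t : G q) : Mat q)),
        A.character t * ν t⁻¹ = ∑ t ∈ Finset.univ.filter (fun t : torusSubgroup eta => CartanDegree.IsScalarMat ((t : G q) : Mat q)),
        ((q : ℂ) ^ 2 - 1) := Finset.sum_congr rfl fun t ht => by
      rw [valA_scalar ψ (Finset.mem_filter.1 ht).2, hνinv_s t (Finset.mem_filter.1 ht).2, mul_one]
    have h2 : ∑ t ∈ Finset.univ.filter (fun t : torusSubgroup eta => ¬ CartanDegree.IsScalarMat ((t : G q) : Mat q)),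
        A.character t * ν t⁻¹ = 0 := Finset.sum_eq_zero fun t ht => by
      rw [valA_torus hq2 hη ψ t.2 (Finset.mem_filter.1 ht).2, zero_mul]
    rw [h1, h2, add_zero, Finset.sum_const, card_scalar_torus hη, nsmul_eq_mul, hcastq1]
  -- (BB) over `T_η`
  have iBB : ∑ t : torusSubgroup eta, B.character t * ν t⁻¹ = ((q : ℂ) - 1) ^ 2 * ((q : ℂ) + 1) := by
    have hcnt := Finset.card_filter_add_card_filter_not
      (s := (Finset.univ : Finset (torusSubgroup eta))) (fun t : torusSubgroup eta => CartanDegree.IsScalarMat ((t : G q) : Mat q))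
    rw [Finset.card_univ, card_torusSubgroup hη, card_scalar_torus hη] at hcnt
    have hcn : (((Finset.univ.filter (fun t : torusSubgroup eta => ¬ CartanDegree.IsScalarMat ((t : G q) : Mat q))).card : ℕ) : ℂ) =
        ((q : ℂ) - 1) * ((q : ℂ) + 1) - ((q : ℂ) - 1) := by
      have h := congrArg (fun n : ℕ => (n : ℂ)) hcnt
      simp only [Nat.cast_add, Nat.cast_mul, hcastq1, Nat.cast_one] at h
      linear_combination h
    have h3 := sum_sq_inv_eq_zero ν hreg
    rw [← Finset.sum_filter_add_sum_filter_not Finset.univ (fun t : torusSubgroup eta => CartanDegree.IsScalarMat ((t : G q) : Mat q))] at h3 ⊢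
    have h4 : ∑ t ∈ Finset.univ.filter (fun t : torusSubgroup eta => CartanDegree.IsScalarMat ((t : G q) : Mat q)), ν t⁻¹ ^ 2 =
        ∑ t ∈ Finset.univ.filter (fun t : torusSubgroup eta => CartanDegree.IsScalarMat ((t : G q) : Mat q)), (1 : ℂ) :=
      Finset.sum_congr rfl fun t ht => by rw [hνinv_s t (Finset.mem_filter.1 ht).2, one_pow]
    rw [h4, Finset.sum_const, card_scalar_torus hη, nsmul_eq_mul, mul_one, hcastq1] at h3
    have h1 : ∑ t ∈ Finset.univ.filter (fun t : torusSubgroup eta => CartanDegree.IsScalarMat ((t : G q) : Mat q)),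
        B.character t * ν t⁻¹ = ∑ t ∈ Finset.univ.filter (fun t : torusSubgroup eta => CartanDegree.IsScalarMat ((t : G q) : Mat q)),
        ((q : ℂ) * ((q : ℂ) - 1)) := Finset.sum_congr rfl fun t ht => by
      rw [valB_scalar hη ν hZ (Finset.mem_filter.1 ht).2, hνinv_s t (Finset.mem_filter.1 ht).2, mul_one]
    have h2 : ∑ t ∈ Finset.univ.filter (fun t : torusSubgroup eta => ¬ CartanDegree.IsScalarMat ((t : G q) : Mat q)),
        B.character t * ν t⁻¹ = ∑ t ∈ Finset.univ.filter (fun t : torusSubgroup eta => ¬ CartanDegree.IsScalarMat ((t : G q) : Mat q)),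
        (1 + ν t⁻¹ ^ 2) := Finset.sum_congr rfl fun t ht => by
      rw [valB_torus hq2 hη ν hZ t.2 (Finset.mem_filter.1 ht).2, map_inv]
      have h0 := hom_ne_zero ν t
      field_simp
    rw [h1, h2, Finset.sum_const, card_scalar_torus hη, nsmul_eq_mul, hcastq1, Finset.sum_add_distrib, Finset.sum_const, nsmul_eq_mul,
      mul_one, hcn]
    linear_combination h3
  -- the four Frobenius pairings
  have eAA := frobenius_pairing (znSub q) (znChar ψ) A
  have eBA := frobenius_pairing (znSub q) (znChar ψ) B
  have eAB := frobenius_pairing (torusSubgroup eta) ν A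
  have eBB := frobenius_pairing (torusSubgroup eta) ν B
  rw [iAA, card_znSub_cast, card_G_cast] at eAA
  rw [iBA, card_znSub_cast, card_G_cast] at eBA
  rw [iAB, card_torus_cast hη, card_G_cast] at eAB
  rw [iBB, card_torus_cast hη, card_G_cast] at eBB
  rw [card_G_cast]
  have hexp : ∑ g : G q, (A.character g - B.character g) * (A.character g⁻¹ - B.character g⁻¹) =
      ∑ g : G q, A.character g * A.character g⁻¹ - ∑ g : G q, A.character g * B.character g⁻¹ -
        (∑ g : G q, B.character g * A.character g⁻¹ - ∑ g : G q, B.character g * B.character g⁻¹) := by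
    rw [← Finset.sum_sub_distrib, ← Finset.sum_sub_distrib, ← Finset.sum_sub_distrib]
    exact Finset.sum_congr rfl fun g _ => by ring
  rw [hexp]
  apply mul_left_cancel₀ (mul_ne_zero (mul_ne_zero hq0 hq1) (mul_ne_zero hq1 hq1'))
  linear_combination ((q : ℂ) - 1) * ((q : ℂ) + 1) * eAA - (q : ℂ) * ((q : ℂ) - 1) * eAB - ((q : ℂ) - 1) * ((q : ℂ) + 1) * eBA +
    (q : ℂ) * ((q : ℂ) - 1) * eBB

/-- **THE IRREDUCIBLE `U_ν`** with `χ_{U_ν} = χ_{Ind_{ZN} ψ} − χ_{Ind_{T_η} ν}` (`ψ ≠ 1`, `ν|_Z = 1`, `ν² ≠ 1`, `q` odd): the cuspidal representation `π(ν)`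
constructed by virtual-character arithmetic alone. -/
theorem exists_irreducible_cuspRow (hq2 : q ≠ 2) (hη : ¬ HasRatEigenvalue eta) {ψ : AddChar (ZMod q) ℂ} (hψ : ψ ≠ 1)
    (ν : torusSubgroup eta →* ℂ) (hZ : ∀ x : torusSubgroup eta, CartanDegree.IsScalarMat ((x : G q) : Mat q) → ν x = 1)
    (hreg : ∃ t : torusSubgroup eta, ν t ^ 2 ≠ 1) :
    ∃ (U : Type) (_ : AddCommGroup U) (_ : Module ℂ U) (_ : FiniteDimensional ℂ U) (ρU : Representation ℂ (G q) U),
      ρU.IsIrreducible ∧ ∀ g, ρU.character g = (monRep (znSub q) (znChar ψ)).character g - (monRep (torusSubgroup eta) ν).character g := by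
  have hpr := (Fact.out : q.Prime)
  have hnorm := normOne_cuspRow hq2 hη hψ ν hZ hreg
  have hA1 : Module.finrank ℂ (G q ⧸ znSub q → ℂ) = (q - 1) * (q + 1) := by
    have h := valA_scalar (q := q) ψ isScalarMat_one
    rw [Representation.char_one] at h
    have h' : ((Module.finrank ℂ (G q ⧸ znSub q → ℂ) : ℕ) : ℂ) = (((q - 1) * (q + 1) : ℕ) : ℂ) := by
      rw [h, Nat.cast_mul, Nat.cast_sub hpr.one_lt.le, Nat.cast_one, Nat.cast_add, Nat.cast_one]; ring
    exact_mod_cast h'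
  have hB1 : Module.finrank ℂ (G q ⧸ torusSubgroup eta → ℂ) = (q - 1) * q := by
    have h := valB_scalar hη ν hZ isScalarMat_one
    rw [Representation.char_one] at h
    have h' : ((Module.finrank ℂ (G q ⧸ torusSubgroup eta → ℂ) : ℕ) : ℂ) = (((q - 1) * q : ℕ) : ℂ) := by
      rw [h, Nat.cast_mul, Nat.cast_sub hpr.one_lt.le, Nat.cast_one]; ring
    exact_mod_cast h'
  have hdim : Module.finrank ℂ (G q ⧸ torusSubgroup eta → ℂ) < Module.finrank ℂ (G q ⧸ znSub q → ℂ) := by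
    rw [hA1, hB1]
    exact Nat.mul_lt_mul_of_pos_left (Nat.lt_succ_self q) (Nat.sub_pos_of_lt hpr.one_lt)
  obtain ⟨U, _, _, _, ρU, hirr, -, hχU⟩ := exists_irreducible_of_virtual_normOne (monRep (znSub q) (znChar ψ)) (monRep (torusSubgroup eta) ν)
    (fun g => (monRep (znSub q) (znChar ψ)).character g - (monRep (torusSubgroup eta) ν).character g) (fun g => rfl) hnorm hdim
  exact ⟨U, _, _, ‹_›, ρU, hirr, hχU⟩

end Cusprow

end Summit.BirchSwinnertonDyer.BirchSwinnertonDyer.Theorems.CartanDoubleCoset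

end
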